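import Literature.AnabelianGeometry.SemiGraphs.HomRestrict
import Literature.AnabelianGeometry.SemiGraphs.CoveringOfObjectVertexAligned
import Literature.AnabelianGeometry.SemiGraphs.GraphOfAnabelioidsGalois
import Literature.AnabelianGeometry.SemiGraphs.CoverticialVertexCaseTools
import HarnessLib

/-!
# Sub-semi-graph components of a finite étale covering: the bridge `Π_K → Π_ℍ → Π_𝒢` and basepoint transport

Mochizuki, *Semi-graphs of anabelioids*, Publ. RIMS **42** (2006), §2, author's manuscript p. 30,
proof of Corollary 2.7 (i): for a finite étale covering `𝒢′ → 𝒢` "whose restriction to `ℍ` we denote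
by `ℋ′ → ℍ`", a connected component `ℋ″` of `ℋ′` and `g ∈ Π_𝒢`, the subgroups `Π_{ℋ″}`,
`Π_{𝒢′} ∩ g · Π_ℍ · g⁻¹ ⊆ Π_𝒢` [cite: MochizukiSemiAnbd2006, Cor. 2.7(i) p.30]; Remark 2.2.1 p. 24
(images of fundamental groups as stabilizers; change of basepoint = conjugation).

abc-iut cell, layer L3, row D3b of the finite étale covering dictionary
(`covering_subgraphComponents_doubleCosets`, `FiniteEtaleCoveringDictionary.lean`, clauses (P3)/(P4)).
PROOF-ONLY file (no definitions, no new facts) supplying, for an ARBITRARY morphism `φ : 𝒢′ → 𝒢`,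
sub-semi-graphs `K ⊆ 𝔾′`, `ℍ ⊆ 𝔾` with `φ(K) ⊆ ℍ`, and basepoints as in (D3):

* **the bridge** (`Hom.range_pi1Map_comp_piHToPi_eq_map`, `Hom.range_ι_comp_piHToPi_eq_map`): the
  image of `Π_K → Π_{𝒢′} → Π_𝒢` (read through `ι`) is the image under `Π_ℍ → Π_𝒢` of the image of
  `Π_K → Π_ℍ` induced by the restricted morphism `ψ := φ|_K : 𝒢′|_K → 𝒢|_ℍ`
  (`SemiGraphOfAnabelioids.Hom.restrict`, `HomRestrict.lean`); hence it lies in `ι(Π_{𝒢′}) ∩ Π_ℍ`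
  (`Hom.range_ι_comp_piHToPi_le`), and it EQUALS `Stab_{Π_𝒢}(x₀) ∩ Π_ℍ` as soon as the restricted
  morphism has image `Stab_{Π_ℍ}(x₀)` (`Hom.range_ι_comp_piHToPi_eq_inf_of_eq_stabilizer`, with
  `map_stabilizer_piHToPi`) — the form in which clause (P3) of (D3) is discharged for the covering of
  record by running the one-anabelioid dictionary (`range_pi1Map_eq_stabilizer`) inside `B(𝒢_ℍ)`;
* **basepoint transport** (`Hom.exists_range_conj_piHToPi_eq_of_aligned`, generic core
  `conj_pi1Map_conj_eq`): if at a vertex `w″ ∈ K` the image of `Π_K` is ALIGNED,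
  `= ι″(Π_{𝒢′}) ∩ Π_ℍ` for basepoints through `w″`, then read through ANY transport `α` of basepoints
  of `B(𝒢′)` to the basepoint through `v′` it is `ι(Π_{𝒢′}) ∩ g⁻¹ Π_ℍ g` for some `g ∈ Π_𝒢` — i.e.
  clause (P4) of (D3) follows from clause (P3) at every vertex of the component (the discrepancy
  between `α` and a transport inside `B(𝒢_ℍ)` is the conjugating element; fibre functors of the Galois
  category `B(𝒢_ℍ)`, `ℍ` connected, are isomorphic).  `Hom.exists_range_conj_piHToPi_eq_of_eq_stabilizer` is the
  stabilizer-form input shape (`ι_ψ(Π_K) = Stab_{Π_ℍ}(a)`, `ι″(Π_{𝒢′}) = Stab_{Π_𝒢}(a)`);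
  `Hom.exists_range_conj_piHToPi_eq_of_aligned'` and `Hom.subgraphComponent_conj_of_aligned` package
  the transport in the binder shape of (D3).

Deliberately NOT here: the alignment itself (clause (P3)) — for an abstract `φ` it is not a
consequence of «local ∧ global ∧ vertex-aligned» (same phenomenon as ruling ρ2 for vertices); it is
proved on the construction side for the covering of record `coveringHomCan` (abc-iut-L3-d3), where
`φ|_K` is the covering of `𝒢_ℍ` attached to the component object `Z_K ∈ B(𝒢_ℍ)`
(`PreimageComponentObject.lean`).  Nothing here takes a side on [IUTchIII] Cor. 3.12; typed ≠ proved.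
-/

namespace Literature.AnabelianGeometry.SemiGraphs

open CategoryTheory CategoryTheory.Functor CategoryTheory.PreGaloisCategory
open Literature.AnabelianGeometry.Anabelioids
open scoped Pointwise

universe w v₁ u₁ u

/-! ### A. Generic: two readings of `π₁(P)` through conjugated basepoints -/

section Generic

variable {B : Type*} [Category B] {C : Type*} [Category C]

/-- Two readings of `π₁(P) : Aut G₁ → Aut(P ⋙ ·)` — through a transport `α : G₁ ≅ G₀` of basepoints
of `C` followed by an identification `e : P ⋙ G₀ ≅ E`, or through an identification `e₂ : P ⋙ G₁ ≅ E₂`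
— differ by conjugation by the discrepancy `δ := e₂⁻¹ ≫ P α ≫ e : E₂ ≅ E`:
`conj_e ∘ π₁(P)_{G₀} ∘ conj_α = conj_δ ∘ conj_{e₂} ∘ π₁(P)_{G₁}` ("independent, up to inner
automorphism, of the choice of basepoint"). [cite: MochizukiGeoAn2004, Def. 1.1.2(ii) p.10] -/
theorem conj_pi1Map_conj_eq (P : B ⥤ C) {G₀ G₁ : C ⥤ FintypeCat.{w}} {E E₂ : B ⥤ FintypeCat.{w}}
    (e : P ⋙ G₀ ≅ E) (e₂ : P ⋙ G₁ ≅ E₂) (α : G₁ ≅ G₀) :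
    ((Aut.autMulEquivOfIso e).toMonoidHom.comp (pi1Map P G₀)).comp
        (Aut.autMulEquivOfIso α).toMonoidHom =
      (Aut.autMulEquivOfIso (e₂.symm ≪≫ isoWhiskerLeft P α ≪≫ e)).toMonoidHom.comp
        ((Aut.autMulEquivOfIso e₂).toMonoidHom.comp (pi1Map P G₁)) := by
  refine MonoidHom.ext fun x => Iso.ext (NatTrans.ext (funext fun X => ?_))
  simp only [MonoidHom.comp_apply, MulEquiv.coe_toMonoidHom, autMulEquivOfIso_hom, Iso.trans_hom,
    Iso.trans_inv, Iso.symm_hom, Iso.symm_inv, isoWhiskerLeft_hom, isoWhiskerLeft_inv,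
    NatTrans.comp_app, whiskerLeft_app, pi1Map_hom_app, Category.assoc, Iso.hom_inv_id_app_assoc]
  rfl

end Generic

namespace SemiGraphOfAnabelioids

variable {𝒢 𝒢' : SemiGraphOfAnabelioids.{v₁, u₁, u}}

/-! ### B. `Π_ℍ → Π_𝒢`, point stabilizers, change of constituent basepoint -/

/-- The image under `Π_ℍ → Π_𝒢` of the stabilizer in `Π_ℍ` of a point `x` of the fibre `F(A_v)`
(`v ∈ ℍ`; `Π_ℍ` acts on the fibres of `A|_ℍ`, which are those of `A`) is `Stab_{Π_𝒢}(x) ∩ Π_ℍ`.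
[cite: MochizukiSemiAnbd2006, Rem. 2.2.1 p.24] -/
theorem map_stabilizer_piHToPi (𝒢 : SemiGraphOfAnabelioids.{v₁, u₁, u}) (H : 𝒢.graph.Subgraph)
    (v : H.toSemiGraph.Vertex) (F : 𝒢.V v.1 ⥤ FintypeCat.{w}) (A : 𝒢.BObj)
    (x : ((𝒢.restrict H).ρ v ⋙ F).obj ((𝒢.restrictFunctor H).obj A)) :
    (MulAction.stabilizer (𝒢.PiH H v F) x).map (𝒢.piHToPi H v F) =
      MulAction.stabilizer (𝒢.Pi v.1 F) (show (𝒢.ρ v.1 ⋙ F).obj A from x) ⊓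
        (𝒢.piHToPi H v F).range := by
  ext g
  simp only [Subgroup.mem_map, Subgroup.mem_inf, MonoidHom.mem_range, MulAction.mem_stabilizer_iff]
  constructor
  · rintro ⟨h, hh, rfl⟩
    exact ⟨hh, h, rfl⟩
  · rintro ⟨hg, h, rfl⟩
    exact ⟨h, hg, rfl⟩

/-- Conjugation by the whiskered identification `ρ_v e` of basepoints of `B(𝒢)` through `v ∈ ℍ`
commutes with `Π_ℍ → Π_𝒢`: `conj_{ρ_v e} ∘ π₁((−)|_ℍ) = π₁((−)|_ℍ) ∘ conj_{ρ^ℍ_v e}`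
(`ρ_v = (−)|_ℍ ⋙ ρ^ℍ_v`). [cite: MochizukiSemiAnbd2006, Def. 2.1 p.24] -/
theorem autMulEquivOfIso_piHToPi (𝒢 : SemiGraphOfAnabelioids.{v₁, u₁, u}) (H : 𝒢.graph.Subgraph)
    (v : H.toSemiGraph.Vertex) {F₁ F₂ : 𝒢.V v.1 ⥤ FintypeCat.{w}} (e : F₁ ≅ F₂) (σ : 𝒢.PiH H v F₁) :
    Aut.autMulEquivOfIso (isoWhiskerLeft (𝒢.ρ v.1) e) (𝒢.piHToPi H v F₁ σ) =
      𝒢.piHToPi H v F₂ (Aut.autMulEquivOfIso (isoWhiskerLeft ((𝒢.restrict H).ρ v) e) σ) :=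
  Iso.ext (NatTrans.ext (funext fun _ => rfl))

/-! ### C. The bridge: `Π_K → Π_{𝒢′} → Π_𝒢` factors through `Π_K → Π_ℍ → Π_𝒢` -/

namespace Hom

variable (φ : Hom 𝒢' 𝒢) (K : 𝒢'.graph.Subgraph) (H : 𝒢.graph.Subgraph)

/-- **Bridge, untransported form** ([SemiAnbd] p. 30: `ℋ′ → ℍ`, and its components "inject into
`𝒢′`"): for a vertex `w ∈ K` and a basepoint `F′` of `𝒢′_w`, the image of `Π_K → Π_{𝒢′} → Π_𝒢`
(basepoint `φ^* ⋙ ρ′_w ⋙ F′ = ρ_{φ w} ⋙ φ_w^* ⋙ F′`) is the image under `Π_ℍ → Π_𝒢` of the image of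
`π₁(ψ^*) : Π_K → Π_ℍ`, `ψ := φ|_K : 𝒢′|_K → 𝒢|_ℍ`. [cite: MochizukiSemiAnbd2006, Cor. 2.7(i) p.30] -/
theorem range_pi1Map_comp_piHToPi_eq_map
    (hV : K.verts ⊆ φ.base.vertexMap ⁻¹' H.verts) (hE : K.edges ⊆ φ.base.edgeMap ⁻¹' H.edges)
    (w : K.toSemiGraph.Vertex) (F' : 𝒢'.V w.1 ⥤ FintypeCat.{w}) :
    ((pi1Map φ.pullbackFunctor (𝒢'.ρ w.1 ⋙ F')).comp (𝒢'.piHToPi K w F')).range =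
      (pi1Map (φ.restrict K H hV hE).pullbackFunctor ((𝒢'.restrict K).ρ w ⋙ F')).range.map
        (𝒢.piHToPi H ⟨φ.base.vertexMap w.1, hV w.2⟩ ((φ.φV w.1).pullback ⋙ F')) :=
  (congrArg MonoidHom.range (φ.pi1Map_pullbackFunctor_comp_piHToPi K H hV hE w F')).trans
    (MonoidHom.range_comp _ _)

/-- **Bridge** ([SemiAnbd] p. 30), in the notation of the dictionary (D3): with `v := φ w`,
`ι := conj_{ρ_v e} ∘ π₁(φ^*) : Π_{𝒢′} → Π_𝒢` for basepoints `F′` of `𝒢′_w`, `F` of `𝒢_v` and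
`e : φ_w^* ⋙ F′ ≅ F`, and the analogous `ι_ψ := conj_{ρ^ℍ_v e} ∘ π₁(ψ^*) : Π_K → Π_ℍ` for the
restricted morphism `ψ := φ|_K : 𝒢′|_K → 𝒢|_ℍ` (same constituent basepoints), the image of
`Π_K → Π_{𝒢′} → Π_𝒢` is `(Π_ℍ → Π_𝒢)(ι_ψ(Π_K))`. [cite: MochizukiSemiAnbd2006, Cor. 2.7(i) p.30] -/
theorem range_ι_comp_piHToPi_eq_map
    (hV : K.verts ⊆ φ.base.vertexMap ⁻¹' H.verts) (hE : K.edges ⊆ φ.base.edgeMap ⁻¹' H.edges)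
    (w : K.toSemiGraph.Vertex) (F' : 𝒢'.V w.1 ⥤ FintypeCat.{w})
    (F : 𝒢.V (φ.base.vertexMap w.1) ⥤ FintypeCat.{w}) (e : (φ.φV w.1).pullback ⋙ F' ≅ F) :
    (((Aut.autMulEquivOfIso (isoWhiskerLeft (𝒢.ρ (φ.base.vertexMap w.1)) e)).toMonoidHom.comp
        (pi1Map φ.pullbackFunctor (𝒢'.ρ w.1 ⋙ F'))).comp (𝒢'.piHToPi K w F')).range =
      ((Aut.autMulEquivOfIso
            (isoWhiskerLeft ((𝒢.restrict H).ρ ⟨φ.base.vertexMap w.1, hV w.2⟩) e)).toMonoidHom.comp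
          (pi1Map (φ.restrict K H hV hE).pullbackFunctor ((𝒢'.restrict K).ρ w ⋙ F'))).range.map
        (𝒢.piHToPi H ⟨φ.base.vertexMap w.1, hV w.2⟩ F) := by
  have key :
      ((Aut.autMulEquivOfIso (isoWhiskerLeft (𝒢.ρ (φ.base.vertexMap w.1)) e)).toMonoidHom.comp
          (pi1Map φ.pullbackFunctor (𝒢'.ρ w.1 ⋙ F'))).comp (𝒢'.piHToPi K w F') =
        (𝒢.piHToPi H ⟨φ.base.vertexMap w.1, hV w.2⟩ F).comp
          ((Aut.autMulEquivOfIso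
              (isoWhiskerLeft ((𝒢.restrict H).ρ ⟨φ.base.vertexMap w.1, hV w.2⟩) e)).toMonoidHom.comp
            (pi1Map (φ.restrict K H hV hE).pullbackFunctor ((𝒢'.restrict K).ρ w ⋙ F'))) := by
    refine MonoidHom.ext fun x => ?_
    have h1 := DFunLike.congr_fun (φ.pi1Map_pullbackFunctor_comp_piHToPi K H hV hE w F') x
    exact (congrArg (Aut.autMulEquivOfIso (isoWhiskerLeft (𝒢.ρ (φ.base.vertexMap w.1)) e)) h1).trans
      (𝒢.autMulEquivOfIso_piHToPi H ⟨φ.base.vertexMap w.1, hV w.2⟩ e _)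
  exact (congrArg MonoidHom.range key).trans (MonoidHom.range_comp _ _)

/-- **Containment** `image(Π_K → Π_{𝒢′} → Π_𝒢) ⊆ ι(Π_{𝒢′}) ∩ Π_ℍ` for every sub-semi-graph `K` with
`φ(K) ⊆ ℍ` (no alignment needed). [cite: MochizukiSemiAnbd2006, Cor. 2.7(i) p.30] -/
theorem range_ι_comp_piHToPi_le
    (hV : K.verts ⊆ φ.base.vertexMap ⁻¹' H.verts) (hE : K.edges ⊆ φ.base.edgeMap ⁻¹' H.edges)
    (w : K.toSemiGraph.Vertex) (F' : 𝒢'.V w.1 ⥤ FintypeCat.{w})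
    (F : 𝒢.V (φ.base.vertexMap w.1) ⥤ FintypeCat.{w}) (e : (φ.φV w.1).pullback ⋙ F' ≅ F) :
    (((Aut.autMulEquivOfIso (isoWhiskerLeft (𝒢.ρ (φ.base.vertexMap w.1)) e)).toMonoidHom.comp
        (pi1Map φ.pullbackFunctor (𝒢'.ρ w.1 ⋙ F'))).comp (𝒢'.piHToPi K w F')).range ≤
      ((Aut.autMulEquivOfIso (isoWhiskerLeft (𝒢.ρ (φ.base.vertexMap w.1)) e)).toMonoidHom.comp
          (pi1Map φ.pullbackFunctor (𝒢'.ρ w.1 ⋙ F'))).range ⊓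
        (𝒢.piHToPi H ⟨φ.base.vertexMap w.1, hV w.2⟩ F).range :=
  le_inf ((MonoidHom.range_comp _ _).le.trans (Subgroup.map_le_range _ _))
    ((φ.range_ι_comp_piHToPi_eq_map K H hV hE w F' F e).le.trans (Subgroup.map_le_range _ _))

/-- **Clause (P3) of (D3) from the restricted morphism**: if `ι_ψ(Π_K) = Stab_{Π_ℍ}(x₀)` for a point
`x₀` of the fibre `F(A_v)` (the one-anabelioid dictionary `range_pi1Map_eq_stabilizer` run in
`B(𝒢_ℍ)` for `ψ = φ|_K`), then the image of `Π_K → Π_{𝒢′} → Π_𝒢` is `Stab_{Π_𝒢}(x₀) ∩ Π_ℍ`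
(= `Π′ ∩ Π_ℍ` when `Π′ = ι(Π_{𝒢′}) = Stab_{Π_𝒢}(x₀)`, Remark 2.2.1).
[cite: MochizukiSemiAnbd2006, Cor. 2.7(i) p.30] -/
theorem range_ι_comp_piHToPi_eq_inf_of_eq_stabilizer
    (hV : K.verts ⊆ φ.base.vertexMap ⁻¹' H.verts) (hE : K.edges ⊆ φ.base.edgeMap ⁻¹' H.edges)
    (w : K.toSemiGraph.Vertex) (F' : 𝒢'.V w.1 ⥤ FintypeCat.{w})
    (F : 𝒢.V (φ.base.vertexMap w.1) ⥤ FintypeCat.{w}) (e : (φ.φV w.1).pullback ⋙ F' ≅ F)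
    (A : 𝒢.BObj) (x₀ : (𝒢.ρ (φ.base.vertexMap w.1) ⋙ F).obj A)
    (hψ : ((Aut.autMulEquivOfIso
            (isoWhiskerLeft ((𝒢.restrict H).ρ ⟨φ.base.vertexMap w.1, hV w.2⟩) e)).toMonoidHom.comp
          (pi1Map (φ.restrict K H hV hE).pullbackFunctor ((𝒢'.restrict K).ρ w ⋙ F'))).range =
      MulAction.stabilizer (𝒢.PiH H ⟨φ.base.vertexMap w.1, hV w.2⟩ F)
        (show ((𝒢.restrict H).ρ ⟨φ.base.vertexMap w.1, hV w.2⟩ ⋙ F).obj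
          ((𝒢.restrictFunctor H).obj A) from x₀)) :
    (((Aut.autMulEquivOfIso (isoWhiskerLeft (𝒢.ρ (φ.base.vertexMap w.1)) e)).toMonoidHom.comp
        (pi1Map φ.pullbackFunctor (𝒢'.ρ w.1 ⋙ F'))).comp (𝒢'.piHToPi K w F')).range =
      MulAction.stabilizer (𝒢.Pi (φ.base.vertexMap w.1) F) x₀ ⊓
        (𝒢.piHToPi H ⟨φ.base.vertexMap w.1, hV w.2⟩ F).range :=
  (φ.range_ι_comp_piHToPi_eq_map K H hV hE w F' F e).trans
    ((congrArg (Subgroup.map (𝒢.piHToPi H ⟨φ.base.vertexMap w.1, hV w.2⟩ F)) hψ).trans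
      (𝒢.map_stabilizer_piHToPi H ⟨φ.base.vertexMap w.1, hV w.2⟩ F A _))

/-! ### D. Basepoint transport: clause (P4) of (D3) from alignment at the vertex -/

/-- **Basepoint transport — clause (P4) of (D3) from alignment at the vertex** ([SemiAnbd] p. 30 with
Remark 2.2.1 p. 24).  Let `φ : 𝒢′ → 𝒢` be any morphism, `ℍ ⊆ 𝔾` a connected sub-semi-graph,
`K ⊆ 𝔾′` a sub-semi-graph and `w″ ∈ K` a vertex over `u := φ w″ ∈ ℍ`.  Suppose that for basepoints
`F″` of `𝒢′_{w″}`, `F₂` of `𝒢_u` and `e₂ : φ_{w″}^* ⋙ F″ ≅ F₂` the image of `Π_K → Π_{𝒢′} → Π_𝒢`,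
read through `ι″ := conj_{ρ_u e₂} ∘ π₁(φ^*)`, is ALIGNED: `= ι″(Π_{𝒢′}) ∩ Π_ℍ^{(u)}`.  Then for the
basepoints `F′` of `𝒢′_{v′}`, `F` of `𝒢_v` (`v := φ v′ ∈ ℍ`), `e : φ_{v′}^* ⋙ F′ ≅ F`, with
`ι := conj_{ρ_v e} ∘ π₁(φ^*)`, and ANY transport `α : ρ′_{w″} ⋙ F″ ≅ ρ′_{v′} ⋙ F′` of basepoints of
`B(𝒢′)`, the image of `Π_K` read through `α` and `ι` is `ι(Π_{𝒢′}) ∩ g⁻¹ Π_ℍ^{(v)} g` for some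
`g ∈ Π_𝒢`: the discrepancy `δ := (ρ_u e₂)⁻¹ ≫ φ^*α ≫ ρ_v e` between `α` and a transport `γ` inside the
Galois category `B(𝒢_ℍ)` (any two fibre functors of which are isomorphic) conjugates `Π_ℍ^{(u)}` onto
`g⁻¹ Π_ℍ^{(v)} g`, `g := δ⁻¹ ≫ (−)|_ℍ γ`. [cite: MochizukiSemiAnbd2006, Cor. 2.7(i) p.30] -/
theorem exists_range_conj_piHToPi_eq_of_aligned (hH : H.toSemiGraph.IsConnected)
    (v' : 𝒢'.graph.Vertex) (F' : 𝒢'.V v' ⥤ FintypeCat.{w})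
    (F : 𝒢.V (φ.base.vertexMap v') ⥤ FintypeCat.{w}) [FiberFunctor F]
    (e : (φ.φV v').pullback ⋙ F' ≅ F) (hv : φ.base.vertexMap v' ∈ H.verts)
    (w'' : K.toSemiGraph.Vertex) (F'' : 𝒢'.V w''.1 ⥤ FintypeCat.{w})
    (F₂ : 𝒢.V (φ.base.vertexMap w''.1) ⥤ FintypeCat.{w}) [FiberFunctor F₂]
    (e₂ : (φ.φV w''.1).pullback ⋙ F'' ≅ F₂) (hu : φ.base.vertexMap w''.1 ∈ H.verts)
    (hal : (((Aut.autMulEquivOfIso (isoWhiskerLeft (𝒢.ρ (φ.base.vertexMap w''.1)) e₂)).toMonoidHom.comp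
        (pi1Map φ.pullbackFunctor (𝒢'.ρ w''.1 ⋙ F''))).comp (𝒢'.piHToPi K w'' F'')).range =
      ((Aut.autMulEquivOfIso (isoWhiskerLeft (𝒢.ρ (φ.base.vertexMap w''.1)) e₂)).toMonoidHom.comp
          (pi1Map φ.pullbackFunctor (𝒢'.ρ w''.1 ⋙ F''))).range ⊓
        (𝒢.piHToPi H ⟨φ.base.vertexMap w''.1, hu⟩ F₂).range)
    (α : 𝒢'.ρ w''.1 ⋙ F'' ≅ 𝒢'.ρ v' ⋙ F') :
    ∃ g : 𝒢.Pi (φ.base.vertexMap v') F,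
      (((Aut.autMulEquivOfIso (isoWhiskerLeft (𝒢.ρ (φ.base.vertexMap v')) e)).toMonoidHom.comp
            (pi1Map φ.pullbackFunctor (𝒢'.ρ v' ⋙ F'))).comp
          ((Aut.autMulEquivOfIso α).toMonoidHom.comp (𝒢'.piHToPi K w'' F''))).range =
        ((Aut.autMulEquivOfIso (isoWhiskerLeft (𝒢.ρ (φ.base.vertexMap v')) e)).toMonoidHom.comp
            (pi1Map φ.pullbackFunctor (𝒢'.ρ v' ⋙ F'))).range ⊓
          ConjAct.toConjAct g⁻¹ • (𝒢.piHToPi H ⟨φ.base.vertexMap v', hv⟩ F).range := by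
  -- notation: `ι` (through `v′`) and `ι₂` (through `w″`)
  set ι : 𝒢'.Pi v' F' →* 𝒢.Pi (φ.base.vertexMap v') F :=
    (Aut.autMulEquivOfIso (isoWhiskerLeft (𝒢.ρ (φ.base.vertexMap v')) e)).toMonoidHom.comp
      (pi1Map φ.pullbackFunctor (𝒢'.ρ v' ⋙ F')) with hιdef
  set ι₂ : 𝒢'.Pi w''.1 F'' →* 𝒢.Pi (φ.base.vertexMap w''.1) F₂ :=
    (Aut.autMulEquivOfIso (isoWhiskerLeft (𝒢.ρ (φ.base.vertexMap w''.1)) e₂)).toMonoidHom.comp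
      (pi1Map φ.pullbackFunctor (𝒢'.ρ w''.1 ⋙ F'')) with hι₂def
  -- the Galois category `B(𝒢_ℍ)` and its fibre functors through `u` and `v`
  letI := (𝒢.restrict H).preGaloisCategory_bObj
  haveI : GaloisCategory (𝒢.restrict H).BObj := (𝒢.restrict H).galoisCategory_bObj ⟨hH⟩
  haveI : @FiberFunctor ((𝒢.restrict H).V ⟨φ.base.vertexMap v', hv⟩)
      ((𝒢.restrict H).catV ⟨φ.base.vertexMap v', hv⟩)
      ((𝒢.restrict H).galV ⟨φ.base.vertexMap v', hv⟩).toPreGaloisCategory F := ‹FiberFunctor F›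
  haveI : @FiberFunctor ((𝒢.restrict H).V ⟨φ.base.vertexMap w''.1, hu⟩)
      ((𝒢.restrict H).catV ⟨φ.base.vertexMap w''.1, hu⟩)
      ((𝒢.restrict H).galV ⟨φ.base.vertexMap w''.1, hu⟩).toPreGaloisCategory F₂ := ‹FiberFunctor F₂›
  haveI : FiberFunctor ((𝒢.restrict H).ρ ⟨φ.base.vertexMap v', hv⟩ ⋙ F) :=
    (𝒢.restrict H).fiberFunctor_ρ ⟨hH⟩ ⟨φ.base.vertexMap v', hv⟩ F
  haveI : FiberFunctor ((𝒢.restrict H).ρ ⟨φ.base.vertexMap w''.1, hu⟩ ⋙ F₂) :=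
    (𝒢.restrict H).fiberFunctor_ρ ⟨hH⟩ ⟨φ.base.vertexMap w''.1, hu⟩ F₂
  obtain ⟨γ⟩ := nonempty_iso_of_fiberFunctor' ((𝒢.restrict H).ρ ⟨φ.base.vertexMap w''.1, hu⟩ ⋙ F₂)
    ((𝒢.restrict H).ρ ⟨φ.base.vertexMap v', hv⟩ ⋙ F)
  -- the discrepancy `δ : ρ_u ⋙ F₂ ≅ ρ_v ⋙ F` between `α` (through `B(𝒢′)`) and the constituents
  let δ : 𝒢.ρ (φ.base.vertexMap w''.1) ⋙ F₂ ≅ 𝒢.ρ (φ.base.vertexMap v') ⋙ F :=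
    (isoWhiskerLeft (𝒢.ρ (φ.base.vertexMap w''.1)) e₂).symm ≪≫ isoWhiskerLeft φ.pullbackFunctor α ≪≫
      isoWhiskerLeft (𝒢.ρ (φ.base.vertexMap v')) e
  obtain ⟨g, hg⟩ := map_range_pi1Map_autMulEquivOfIso (𝒢.restrictFunctor H) γ δ
  have hg' : (𝒢.piHToPi H ⟨φ.base.vertexMap w''.1, hu⟩ F₂).range.map
        (Aut.autMulEquivOfIso δ).toMonoidHom =
      ConjAct.toConjAct (g⁻¹ : 𝒢.Pi (φ.base.vertexMap v') F) •
        (𝒢.piHToPi H ⟨φ.base.vertexMap v', hv⟩ F).range := hg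
  refine ⟨g, ?_⟩
  -- factorisation through `ι₂`: `ι ∘ conj_α = conj_δ ∘ ι₂`
  have hfac : ι.comp (Aut.autMulEquivOfIso α).toMonoidHom =
      (Aut.autMulEquivOfIso δ).toMonoidHom.comp ι₂ :=
    conj_pi1Map_conj_eq φ.pullbackFunctor (G₀ := 𝒢'.ρ v' ⋙ F') (G₁ := 𝒢'.ρ w''.1 ⋙ F'')
      (E := 𝒢.ρ (φ.base.vertexMap v') ⋙ F) (E₂ := 𝒢.ρ (φ.base.vertexMap w''.1) ⋙ F₂)
      (isoWhiskerLeft (𝒢.ρ (φ.base.vertexMap v')) e)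
      (isoWhiskerLeft (𝒢.ρ (φ.base.vertexMap w''.1)) e₂) α
  have hιrange : ι₂.range.map (Aut.autMulEquivOfIso δ).toMonoidHom = ι.range := by
    rw [← MonoidHom.range_comp, ← hfac, MonoidHom.range_comp,
      MonoidHom.range_eq_top_of_surjective (Aut.autMulEquivOfIso α).toMonoidHom
        (Aut.autMulEquivOfIso α).surjective, ← MonoidHom.range_eq_map]
  have h1 : ι.comp ((Aut.autMulEquivOfIso α).toMonoidHom.comp (𝒢'.piHToPi K w'' F'')) =
      (Aut.autMulEquivOfIso δ).toMonoidHom.comp (ι₂.comp (𝒢'.piHToPi K w'' F'')) := by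
    rw [← MonoidHom.comp_assoc, hfac, MonoidHom.comp_assoc]
  rw [h1, MonoidHom.range_comp, hal,
    Subgroup.map_inf _ _ (Aut.autMulEquivOfIso δ).toMonoidHom (Aut.autMulEquivOfIso δ).injective,
    hιrange, hg']

/-- **Clause (P4) of (D3) in stabilizer form** (the shape delivered by the (CORE)/(COMP) pieces of
the D3b cut, ruling α7-1): if at the vertex `w″ ∈ K`, for constituent basepoints `(F″, F₂, e₂)`, the
restricted morphism `ψ = φ|_K` has image `ι_ψ(Π_K) = Stab_{Π_ℍ}(a)` and `ι″(Π_{𝒢′}) = Stab_{Π_𝒢}(a)`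
for one point `a` of the fibre `F₂(A_u)` (`u = φ w″`; Remark 2.2.1: decomposition groups), then for
ANY transport `α` of basepoints of `B(𝒢′)` the image of `Π_K` read through `α` and `ι` is
`ι(Π_{𝒢′}) ∩ g⁻¹ Π_ℍ g` for some `g ∈ Π_𝒢`. [cite: MochizukiSemiAnbd2006, Cor. 2.7(i) p.30] -/
theorem exists_range_conj_piHToPi_eq_of_eq_stabilizer (hH : H.toSemiGraph.IsConnected)
    (hV : K.verts ⊆ φ.base.vertexMap ⁻¹' H.verts) (hE : K.edges ⊆ φ.base.edgeMap ⁻¹' H.edges)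
    (v' : 𝒢'.graph.Vertex) (F' : 𝒢'.V v' ⥤ FintypeCat.{w})
    (F : 𝒢.V (φ.base.vertexMap v') ⥤ FintypeCat.{w}) [FiberFunctor F]
    (e : (φ.φV v').pullback ⋙ F' ≅ F) (hv : φ.base.vertexMap v' ∈ H.verts)
    (w'' : K.toSemiGraph.Vertex) (F'' : 𝒢'.V w''.1 ⥤ FintypeCat.{w})
    (F₂ : 𝒢.V (φ.base.vertexMap w''.1) ⥤ FintypeCat.{w}) [FiberFunctor F₂]
    (e₂ : (φ.φV w''.1).pullback ⋙ F'' ≅ F₂)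
    (A : 𝒢.BObj) (a : (𝒢.ρ (φ.base.vertexMap w''.1) ⋙ F₂).obj A)
    (hψ : ((Aut.autMulEquivOfIso
            (isoWhiskerLeft ((𝒢.restrict H).ρ ⟨φ.base.vertexMap w''.1, hV w''.2⟩) e₂)).toMonoidHom.comp
          (pi1Map (φ.restrict K H hV hE).pullbackFunctor ((𝒢'.restrict K).ρ w'' ⋙ F''))).range =
      MulAction.stabilizer (𝒢.PiH H ⟨φ.base.vertexMap w''.1, hV w''.2⟩ F₂)
        (show ((𝒢.restrict H).ρ ⟨φ.base.vertexMap w''.1, hV w''.2⟩ ⋙ F₂).obj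
          ((𝒢.restrictFunctor H).obj A) from a))
    (hι : ((Aut.autMulEquivOfIso (isoWhiskerLeft (𝒢.ρ (φ.base.vertexMap w''.1)) e₂)).toMonoidHom.comp
        (pi1Map φ.pullbackFunctor (𝒢'.ρ w''.1 ⋙ F''))).range =
      MulAction.stabilizer (𝒢.Pi (φ.base.vertexMap w''.1) F₂) a)
    (α : 𝒢'.ρ w''.1 ⋙ F'' ≅ 𝒢'.ρ v' ⋙ F') :
    ∃ g : 𝒢.Pi (φ.base.vertexMap v') F,
      (((Aut.autMulEquivOfIso (isoWhiskerLeft (𝒢.ρ (φ.base.vertexMap v')) e)).toMonoidHom.comp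
            (pi1Map φ.pullbackFunctor (𝒢'.ρ v' ⋙ F'))).comp
          ((Aut.autMulEquivOfIso α).toMonoidHom.comp (𝒢'.piHToPi K w'' F''))).range =
        ((Aut.autMulEquivOfIso (isoWhiskerLeft (𝒢.ρ (φ.base.vertexMap v')) e)).toMonoidHom.comp
            (pi1Map φ.pullbackFunctor (𝒢'.ρ v' ⋙ F'))).range ⊓
          ConjAct.toConjAct g⁻¹ • (𝒢.piHToPi H ⟨φ.base.vertexMap v', hv⟩ F).range :=
  φ.exists_range_conj_piHToPi_eq_of_aligned K H hH v' F' F e hv w'' F'' F₂ e₂ (hV w''.2)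
    ((φ.range_ι_comp_piHToPi_eq_inf_of_eq_stabilizer K H hV hE w'' F'' F₂ e₂ A a hψ).trans
      (congrArg (· ⊓ (𝒢.piHToPi H ⟨φ.base.vertexMap w''.1, hV w''.2⟩ F₂).range) hι).symm)
    α

/-- **Basepoint transport, (D3) shape**: as `exists_range_conj_piHToPi_eq_of_aligned`, with the
alignment hypothesis at `w″` quantified over the constituent basepoints `(F₂, e₂)` exactly as clause
(P3) of (D3) quantifies it, and instantiated internally at `F₂ := φ_{w″}^* ⋙ F″` (a basepoint of
`𝒢_u`: `φ_{w″}^*` is exact). [cite: MochizukiSemiAnbd2006, Cor. 2.7(i) p.30] -/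
theorem exists_range_conj_piHToPi_eq_of_aligned' (hH : H.toSemiGraph.IsConnected)
    (v' : 𝒢'.graph.Vertex) (F' : 𝒢'.V v' ⥤ FintypeCat.{w})
    (F : 𝒢.V (φ.base.vertexMap v') ⥤ FintypeCat.{w}) [FiberFunctor F]
    (e : (φ.φV v').pullback ⋙ F' ≅ F) (hv : φ.base.vertexMap v' ∈ H.verts)
    (w'' : K.toSemiGraph.Vertex) (F'' : 𝒢'.V w''.1 ⥤ FintypeCat.{w}) [FiberFunctor F'']
    (hu : φ.base.vertexMap w''.1 ∈ H.verts)
    (hal : ∀ (F₂ : 𝒢.V (φ.base.vertexMap w''.1) ⥤ FintypeCat.{w}) [FiberFunctor F₂]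
      (e₂ : (φ.φV w''.1).pullback ⋙ F'' ≅ F₂),
      (((Aut.autMulEquivOfIso (isoWhiskerLeft (𝒢.ρ (φ.base.vertexMap w''.1)) e₂)).toMonoidHom.comp
          (pi1Map φ.pullbackFunctor (𝒢'.ρ w''.1 ⋙ F''))).comp (𝒢'.piHToPi K w'' F'')).range =
        ((Aut.autMulEquivOfIso (isoWhiskerLeft (𝒢.ρ (φ.base.vertexMap w''.1)) e₂)).toMonoidHom.comp
            (pi1Map φ.pullbackFunctor (𝒢'.ρ w''.1 ⋙ F''))).range ⊓
          (𝒢.piHToPi H ⟨φ.base.vertexMap w''.1, hu⟩ F₂).range)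
    (α : 𝒢'.ρ w''.1 ⋙ F'' ≅ 𝒢'.ρ v' ⋙ F') :
    ∃ g : 𝒢.Pi (φ.base.vertexMap v') F,
      (((Aut.autMulEquivOfIso (isoWhiskerLeft (𝒢.ρ (φ.base.vertexMap v')) e)).toMonoidHom.comp
            (pi1Map φ.pullbackFunctor (𝒢'.ρ v' ⋙ F'))).comp
          ((Aut.autMulEquivOfIso α).toMonoidHom.comp (𝒢'.piHToPi K w'' F''))).range =
        ((Aut.autMulEquivOfIso (isoWhiskerLeft (𝒢.ρ (φ.base.vertexMap v')) e)).toMonoidHom.comp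
            (pi1Map φ.pullbackFunctor (𝒢'.ρ v' ⋙ F'))).range ⊓
          ConjAct.toConjAct g⁻¹ • (𝒢.piHToPi H ⟨φ.base.vertexMap v', hv⟩ F).range := by
  haveI : Limits.PreservesFiniteLimits (φ.φV w''.1).pullback := (φ.φV w''.1).property.1
  haveI : Limits.PreservesFiniteColimits (φ.φV w''.1).pullback := (φ.φV w''.1).property.2
  haveI : FiberFunctor ((φ.φV w''.1).pullback ⋙ F'') :=
    fiberFunctor_comp_of_exact (φ.φV w''.1).pullback F''
  exact φ.exists_range_conj_piHToPi_eq_of_aligned K H hH v' F' F e hv w'' F''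
    ((φ.φV w''.1).pullback ⋙ F'') (Iso.refl _) hu (hal _ (Iso.refl _)) α

/-- **Clause (P4) of (D3) from clause (P3) at every vertex of the component** — the binder shape of
`covering_subgraphComponents_doubleCosets`: for `ℍ` connected, basepoints `(F′, F, e)` through
`v′ ↦ v ∈ ℍ` and a sub-semi-graph `K ⊆ 𝔾′` with `φ(K) ⊆ ℍ` (vertices) at every vertex of which the
image of `Π_K` is aligned (for all constituent basepoints), the image of
`Π_K → Π_{𝒢′} → Π_𝒢` read through any vertex `w″ ∈ K`, any basepoint `F″` and any transport `α` of
basepoints of `B(𝒢′)` is `ι(Π_{𝒢′}) ∩ g⁻¹ Π_ℍ g` for some `g ∈ Π_𝒢` ([SemiAnbd] p. 30: the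
subgroups `Π_{𝒢′} ∩ g · Π_ℍ · g⁻¹` attached to the components `g · ℋ″`).
[cite: MochizukiSemiAnbd2006, Cor. 2.7(i) p.30] -/
theorem subgraphComponent_conj_of_aligned (hH : H.toSemiGraph.IsConnected)
    (v' : 𝒢'.graph.Vertex) (F' : 𝒢'.V v' ⥤ FintypeCat.{w})
    (F : 𝒢.V (φ.base.vertexMap v') ⥤ FintypeCat.{w}) [FiberFunctor F]
    (e : (φ.φV v').pullback ⋙ F' ≅ F) (hv : φ.base.vertexMap v' ∈ H.verts)
    (hKV : K.verts ⊆ φ.base.vertexMap ⁻¹' H.verts)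
    (hal : ∀ (w'' : K.toSemiGraph.Vertex) (F'' : 𝒢'.V w''.1 ⥤ FintypeCat.{w}) [FiberFunctor F'']
      (F₂ : 𝒢.V (φ.base.vertexMap w''.1) ⥤ FintypeCat.{w}) [FiberFunctor F₂]
      (e₂ : (φ.φV w''.1).pullback ⋙ F'' ≅ F₂),
      (((Aut.autMulEquivOfIso (isoWhiskerLeft (𝒢.ρ (φ.base.vertexMap w''.1)) e₂)).toMonoidHom.comp
          (pi1Map φ.pullbackFunctor (𝒢'.ρ w''.1 ⋙ F''))).comp (𝒢'.piHToPi K w'' F'')).range =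
        ((Aut.autMulEquivOfIso (isoWhiskerLeft (𝒢.ρ (φ.base.vertexMap w''.1)) e₂)).toMonoidHom.comp
            (pi1Map φ.pullbackFunctor (𝒢'.ρ w''.1 ⋙ F''))).range ⊓
          (𝒢.piHToPi H ⟨φ.base.vertexMap w''.1, hKV w''.2⟩ F₂).range)
    (w'' : K.toSemiGraph.Vertex) (F'' : 𝒢'.V w''.1 ⥤ FintypeCat.{w}) [FiberFunctor F'']
    (α : 𝒢'.ρ w''.1 ⋙ F'' ≅ 𝒢'.ρ v' ⋙ F') :
    ∃ g : 𝒢.Pi (φ.base.vertexMap v') F,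
      (((Aut.autMulEquivOfIso (isoWhiskerLeft (𝒢.ρ (φ.base.vertexMap v')) e)).toMonoidHom.comp
            (pi1Map φ.pullbackFunctor (𝒢'.ρ v' ⋙ F'))).comp
          ((Aut.autMulEquivOfIso α).toMonoidHom.comp (𝒢'.piHToPi K w'' F''))).range =
        ((Aut.autMulEquivOfIso (isoWhiskerLeft (𝒢.ρ (φ.base.vertexMap v')) e)).toMonoidHom.comp
            (pi1Map φ.pullbackFunctor (𝒢'.ρ v' ⋙ F'))).range ⊓
          ConjAct.toConjAct g⁻¹ • (𝒢.piHToPi H ⟨φ.base.vertexMap v', hv⟩ F).range :=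
  φ.exists_range_conj_piHToPi_eq_of_aligned' K H hH v' F' F e hv w'' F'' (hKV w''.2)
    (fun F₂ _ e₂ => hal w'' F'' F₂ e₂) α

end Hom

end SemiGraphOfAnabelioids

end Literature.AnabelianGeometry.SemiGraphs
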